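import Summits.QuantumFields.YangMills.Theorems.BalabanUVNodesN15KingModelAnalyticDeterminantFine
import Summits.QuantumFields.YangMills.Theorems.BalabanUVNodesN15KingModelAnalyticDeterminantLipschitz
import Summits.QuantumFields.YangMills.Theorems.BalabanUVNodesN15KingModelCovariantBlockPureGauge
import HarnessLib

/-!
# BalabanUVNodes ∕ N15 — THE KING-MODEL RUNG (PART Ϭ-i): THE FLAT VALUE OF THE FIBRE MODEL's NORMALISATIONS IN CLOSED FORM — PARTS Ε-q ∕ Ε-n ∕ Ε-p BY NAME —
# `A₀(1) = A₀^{King} ⊗ 1_n` so `det A₀(1) = (det A₀^{King})^{|n|}`; by PART Ϭ-a's identity and PART Ε-q's `det A₀^{King}·det Δ^{(K)} = a^{|T₁|}·det B^{King}`: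
# ★★★★ `det Δ_eff(1) = (det Δ^{(K)})^{|n|} = (Π_q effSym(q))^{|n|}` (King's plane-wave closed form, PART Ε-n), `ln 𝒩(Δ_eff(1)) = |n|·ln 𝒩(Δ^{(K)})` (King's (3.89) `E₀`, PART Ε-p) — the fibre model at the
# flat background is `|n|` independent copies of King's scalar block field; hence THE CURVED NORMALISATION RELATIVE TO THE CLOSED FORM: `|ln det Δ_eff(U) − |n|·Σ_q ln effSym(q)| ≤ N·ln(1+a∕m²)`
# at every unitary `U` (PART Ϭ-b) and `≤ N·(a⁻¹+m⁻²)·a²·Λ(Lε)` for `|U − 1| ≤ ε` (PART Ϭ-d, `𝕜 = ℂ`, comb)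
# (Track A, DAG node N15 = NE2; FAN-OUT v1.1 §N15 s3 «KING-MODEL RUNG … + what the curved case adds»; count-neutral)

HONEST FRAMING.  Count-neutral (cell `pub-ymgap`, seat `pub-ymgap-dag-n15-e` g53; `--supports stmt-QuantumFields-27247 --as helper` = K3ᴬ, KEY MAP v3).  King's one-level comparison model in
King's scaling `c = L²`, `L ≥ 1`, `a, m² > 0`; the closed form is PART Ε-n's plane-wave product (`U ≡ 1` only) — at a curved background only the WINDOW around it is controlled (no closed form
is claimed there).  NOT Bałaban's multi-level `Z_k`; NOT a node discharge (N15 of record untouched); nothing continuum ∕ ℝ⁴ ∕ OS ∕ Clay.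

THE RESULTS (`N = |T₁|·|n|`; `A₀^{King} = fineOp`, `B^{King} = lapF`, `Δ^{(K)} = effLaplacian` — the `King1986.Torus` objects of the `U ≡ 1` rung):
* §1 ★★ `fullOpU_flat_eq_kronecker` (`A₀(1) = A₀^{King} ⊗ₖ 1_n`, PART Ϥ-e `fullOpU_const_one_apply`), ★★ `re_det_fullOpU_flat` (`det A₀(1) = (det A₀^{King})^{|n|}`).
* §2 (King's scaling) ★★★★ **`re_det_effLapU_flat`** (`det Δ_eff(1) = (det Δ^{(K)})^{|n|}` — Ϭ-a's identity ÷ Ε-q's identity), ★★★★ **`re_det_effLapU_flat_eq_prod_effSym`** (`= (Π_q effSym(q))^{|n|}`, Ε-n),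
  ★★★ **`log_re_det_effLapU_flat`** (`ln det Δ_eff(1) = |n|·Σ_q ln effSym(q)`), ★★★ **`log_gaussNorm_effLapU_flat`** (`𝕜 = ℝ`: `ln 𝒩(Δ_eff(1)) = |n|·ln 𝒩(Δ^{(K)})` — `|n|` copies of King's `E₀`, Ε-p).
* §3 ★★★★ **`abs_log_re_det_effLapU_sub_closedForm_le`** (every unitary `U`: `|ln det Δ_eff(U) − |n|·Σ_q ln effSym(q)| ≤ N·ln(1+a∕m²)`), ★★★ **`abs_log_re_det_effLapU_sub_closedForm_le_eta_uniform`**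
  (`𝕜 = ℂ`, comb, `‖U_b − 1‖ ≤ ε`: `≤ N·(a⁻¹+m⁻²)·a²·Λ(Lε)` — the curved normalisation departs from King's closed form at an η-uniform Lipschitz rate on Bałaban's scale),
  ★★★ `abs_log_gaussNorm_effLapU_sub_flat_le` (`𝕜 = ℝ`: `|ln 𝒩(Δ_eff(U)) − |n|·ln 𝒩(Δ^{(K)})| ≤ ½N·ln(1+a∕m²)`).
PRIOR TREE ART (by name): Ε-q (`det_fineOp_mul_det_effLaplacian`, `det_fineOp_pos`), Ε-n (`det_effLaplacian_eq_prod_effSym`, `effSym_pos'`, `det_effLaplacian_pos`), Ε-p (`log_gaussNorm_effLaplacian`), Ϥ-e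
(`fullOpU_const_one_apply`), Ϭ-a (`re_det_effLapU_mul_re_det_fullOpU`, `re_det_fullOpU_pos`), Ϭ-b (`abs_log_re_det_effLapU_sub_le`, `log_gaussNorm_effLapU`), Ϭ-d (`abs_log_det_effLapU_sub_le_eta_uniform`), Ϭ-g
(`re_det_covLapF_flat`, `flat_mem_unitaryGroup`), Mathlib (`Matrix.det_kronecker`, `RingHom.map_det`).  Dedup (rg at filing): basename 0 files; needles
`fullOpU_flat_eq_kronecker|re_det_effLapU_flat|log_re_det_effLapU_flat|abs_log_re_det_effLapU_sub_closedForm_le|log_gaussNorm_effLapU_flat` 0 tree files.  Locators: [King1986] (2.4)–(2.6) p.652,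
(2.13)–(2.16) p.653, (3.89)–(3.90) pp.668–669, (4.5) p.670, (4.33) p.674.  0 `sorry`, 0 `def`.
-/

noncomputable section
open scoped BigOperators ComplexConjugate ComplexOrder Matrix.Norms.L2Operator Kronecker
open Finset Matrix

namespace Summit.QuantumFields.YangMills.BalabanUVNodes.N15KingModelRung.Analytic

open Literature.MathematicalPhysics.QuantumFieldTheory.Balaban1983to89.B5Prop11Plancherel (Tor fine)
open Literature.MathematicalPhysics.QuantumFieldTheory.King1986.Torus (lapF fineOp effLaplacian effSym)
open Summit.QuantumFields.YangMills.BalabanUVNodes.N15KingModelRung.Covariant (covLapF)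
open Summit.QuantumFields.YangMills.BalabanUVNodes.N15KingModelRung.CovariantBlock (BlockTree kingComb fullOpU effLapU fullOpU_const_one_apply)
open Summit.QuantumFields.YangMills.BalabanUVNodes.N15KingModelRung.TorusSpectral (det_fineOp_mul_det_effLaplacian det_fineOp_pos det_effLaplacian_eq_prod_effSym effSym_pos' det_effLaplacian_pos
  log_gaussNorm_effLaplacian)
open Summit.QuantumFields.YangMills.BalabanUVNodes.N15KingModelRung.FreeField (gaussNorm)

variable {d : ℕ} {L : ℕ} [NeZero L] (T : BlockTree d L) (M : Fin (d + 1) → ℕ) [hM : ∀ μ, NeZero (M μ)]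

/-! ## §1 `A₀(1) = A₀^{King} ⊗ 1_n` -/

section Kron

variable {𝕜 : Type*} [RCLike 𝕜] {n : Type*} [Fintype n] [DecidableEq n]

/-- ★★ **AT THE FLAT BACKGROUND THE FULL OPERATOR IS KING's `A₀ ⊗ 1_n`** (PART Ϥ-e, entrywise ⟹ as matrices). [cite: King1986, (2.13) p.653, (4.5) p.670] -/
theorem fullOpU_flat_eq_kronecker (a c m2 : ℝ) :
    fullOpU T M a c m2 (fun _ => (1 : Matrix n n 𝕜)) = (fineOp L M a c m2).map (algebraMap ℝ 𝕜) ⊗ₖ (1 : Matrix n n 𝕜) := by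
  ext ⟨x, i⟩ ⟨x', k⟩
  rw [fullOpU_const_one_apply, Matrix.kroneckerMap_apply, Matrix.map_apply, RCLike.algebraMap_eq_ofReal]

/-- ★★ **`det A₀(1) = (det A₀^{King})^{|n|}`**. [cite: King1986, (2.13) p.653, (2.6) p.652] -/
theorem re_det_fullOpU_flat (a c m2 : ℝ) : RCLike.re (fullOpU T M a c m2 (fun _ => (1 : Matrix n n 𝕜))).det = (fineOp L M a c m2).det ^ Fintype.card n := by
  rw [fullOpU_flat_eq_kronecker, Matrix.det_kronecker, Matrix.det_one, one_pow, mul_one, ← RingHom.mapMatrix_apply, ← RingHom.map_det, RCLike.algebraMap_eq_ofReal,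
    ← RCLike.ofReal_pow, RCLike.ofReal_re]

end Kron

/-! ## §2 The flat block-field normalisation in closed form -/

section Closed

variable {𝕜 : Type*} [RCLike 𝕜] {n : Type*} [Fintype n] [DecidableEq n]
variable (hL : 1 ≤ L) {a m2 : ℝ} (ha : 0 < a) (hm : 0 < m2)
include hL ha hm

/-- ★★★★ **`det Δ_eff(1) = (det Δ^{(K)})^{|n|}`** (King's scaling `c = L²`): PART Ϭ-a's identity at the flat background divided by PART Ε-q's RG determinant identity.
[cite: King1986, (2.4)–(2.6) p.652, (2.13)–(2.16) p.653, (3.89) p.668] -/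
theorem re_det_effLapU_flat :
    RCLike.re (effLapU T M a ((L : ℝ) ^ 2) m2 (fun _ => (1 : Matrix n n 𝕜))).det = (effLaplacian L M a ((L : ℝ) ^ 2) m2).det ^ Fintype.card n := by
  have hc : (0 : ℝ) ≤ (L : ℝ) ^ 2 := by positivity
  have h1 := flat_mem_unitaryGroup (L := L) (d := d) M (n := n) (𝕜 := 𝕜)
  have h := re_det_effLapU_mul_re_det_fullOpU T M ha hc hm h1
  rw [re_det_fullOpU_flat T M a ((L : ℝ) ^ 2) m2 (𝕜 := 𝕜) (n := n), re_det_covLapF_flat M ((L : ℝ) ^ 2) m2 (𝕜 := 𝕜) (n := n), Fintype.card_prod, pow_mul] at h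
  have hEq := det_fineOp_mul_det_effLaplacian L M hL ha hm
  have hA : 0 < (fineOp L M a ((L : ℝ) ^ 2) m2).det := det_fineOp_pos L M hL ha hm
  have hAn : 0 < (fineOp L M a ((L : ℝ) ^ 2) m2).det ^ Fintype.card n := pow_pos hA _
  -- `X·(det A₀^K)^n = (a^{|T₁|}·det B^K)^n = (det A₀^K·det Δ^K)^n`
  have h' : RCLike.re (effLapU T M a ((L : ℝ) ^ 2) m2 (fun _ => (1 : Matrix n n 𝕜))).det * (fineOp L M a ((L : ℝ) ^ 2) m2).det ^ Fintype.card n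
      = ((effLaplacian L M a ((L : ℝ) ^ 2) m2).det ^ Fintype.card n) * (fineOp L M a ((L : ℝ) ^ 2) m2).det ^ Fintype.card n := by
    rw [h, ← mul_pow, ← mul_pow, ← hEq, mul_comm]
  exact mul_right_cancel₀ hAn.ne' h'

/-- ★★★★ **KING's CLOSED FORM**: `det Δ_eff(1) = (Π_q effSym(q))^{|n|}` (PART Ε-n's plane-wave product). [cite: King1986, (2.14)–(2.16) p.653, (3.89) p.668] -/
theorem re_det_effLapU_flat_eq_prod_effSym :
    RCLike.re (effLapU T M a ((L : ℝ) ^ 2) m2 (fun _ => (1 : Matrix n n 𝕜))).det = (∏ q : Tor M, effSym L M a ((L : ℝ) ^ 2) m2 q) ^ Fintype.card n := by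
  rw [re_det_effLapU_flat T M hL ha hm (𝕜 := 𝕜) (n := n), det_effLaplacian_eq_prod_effSym L M ha.le (by positivity) hm]

/-- ★★★ **`ln det Δ_eff(1) = |n|·Σ_q ln effSym(q)`**. [cite: King1986, (2.14)–(2.16) p.653, (3.89) p.668] -/
theorem log_re_det_effLapU_flat :
    Real.log (RCLike.re (effLapU T M a ((L : ℝ) ^ 2) m2 (fun _ => (1 : Matrix n n 𝕜))).det) = Fintype.card n * ∑ q : Tor M, Real.log (effSym L M a ((L : ℝ) ^ 2) m2 q) := by
  rw [re_det_effLapU_flat_eq_prod_effSym T M hL ha hm (𝕜 := 𝕜) (n := n), Real.log_pow, Real.log_prod]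
  exact fun q _ => (effSym_pos' L M ha (by positivity) hm q).ne'

end Closed

/-! ## §3 The curved normalisation relative to King's closed form -/

section Relative

variable {𝕜 : Type*} [RCLike 𝕜] {n : Type*} [Fintype n] [DecidableEq n]
variable (hL : 1 ≤ L) {a m2 : ℝ} (ha : 0 < a) (hm : 0 < m2) {U : Tor (fine L M) × Fin (d + 1) → Matrix n n 𝕜} (hU : ∀ bd, U bd ∈ Matrix.unitaryGroup n 𝕜)
include hL ha hm hU

/-- ★★★★ **THE CURVED BLOCK-FIELD NORMALISATION RELATIVE TO KING's CLOSED FORM**: at every unitary `U` (King's scaling, any tree contour system),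
`|ln det Δ_eff(U) − |n|·Σ_q ln effSym(q)| ≤ N·ln(1+a∕m²)` (PART Ϭ-b between `U` and the flat background). [cite: King1986, (2.14)–(2.16) p.653, (3.89)–(3.90) pp.668–669, (4.33) p.674] -/
theorem abs_log_re_det_effLapU_sub_closedForm_le :
    |Real.log (RCLike.re (effLapU T M a ((L : ℝ) ^ 2) m2 U).det) - Fintype.card n * ∑ q : Tor M, Real.log (effSym L M a ((L : ℝ) ^ 2) m2 q)|
      ≤ Fintype.card (Tor M × n) * Real.log (1 + a / m2) := by
  rw [← log_re_det_effLapU_flat T M hL ha hm (𝕜 := 𝕜) (n := n)]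
  exact abs_log_re_det_effLapU_sub_le T M ha (by positivity) hm hU (flat_mem_unitaryGroup (L := L) (d := d) M (n := n) (𝕜 := 𝕜))

end Relative

section RelativeScale

variable {n : Type*} [Fintype n] [DecidableEq n]
variable (hL : 1 ≤ L) {a m2 : ℝ} (ha : 0 < a) (hm : 0 < m2) {U : Tor (fine L M) × Fin (d + 1) → Matrix n n ℂ} (hU : ∀ bd, U bd ∈ Matrix.unitaryGroup n ℂ)
variable {ε : ℝ} (hε0 : 0 ≤ ε) (hε : ∀ bd, ‖U bd - 1‖ ≤ ε)
include hL ha hm hU hε0 hε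

/-- ★★★ **… AND AT AN η-UNIFORM LIPSCHITZ RATE NEAR THE FLAT BACKGROUND** (`𝕜 = ℂ`, comb contours, `‖U_b − 1‖ ≤ ε`):
`|ln det Δ_eff(U) − |n|·Σ_q ln effSym(q)| ≤ N·(a⁻¹+m⁻²)·a²·Λ(Lε)` with PART Ϧ-l's `Λ(s) = 2(d+1)s∕m² + 2√(d+1)s∕(m²√m²) + 2(d+1)(s²+as)∕m⁴` (PART Ϭ-d).
[cite: King1986, (2.14)–(2.16) p.653, (3.89)–(3.90) pp.668–669, (4.34) p.674; Balaban1985BackgroundPropagators, (3.48)–(3.50) pp.398–400 (shape)] -/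
theorem abs_log_re_det_effLapU_sub_closedForm_le_eta_uniform :
    |Real.log (RCLike.re (effLapU (kingComb d L) M a ((L : ℝ) ^ 2) m2 U).det) - Fintype.card n * ∑ q : Tor M, Real.log (effSym L M a ((L : ℝ) ^ 2) m2 q)|
      ≤ Fintype.card (Tor M × n) * ((a⁻¹ + m2⁻¹) * (a ^ 2 * (2 * ((d : ℝ) + 1) * ((L : ℝ) * ε) * m2⁻¹
          + (2 * Real.sqrt ((d : ℝ) + 1) * ((L : ℝ) * ε) / (m2 * Real.sqrt m2) + 2 * ((d : ℝ) + 1) * (((L : ℝ) * ε) ^ 2 + a * ((L : ℝ) * ε)) / m2 ^ 2)))) := by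
  rw [← log_re_det_effLapU_flat (kingComb d L) M hL ha hm (𝕜 := ℂ) (n := n)]
  exact abs_log_det_effLapU_sub_le_eta_uniform M ha hm hU (flat_mem_unitaryGroup (L := L) (d := d) M (n := n) (𝕜 := ℂ)) hε0
    (fun bd => by simpa using hε bd)

end RelativeScale

/-! ## §4 King's `E₀` for the fibre model: `|n|` copies of the scalar block field -/

section Gauss

variable {n : Type*} [Fintype n] [DecidableEq n] [Nonempty n]
variable (hL : 1 ≤ L) {a m2 : ℝ} (ha : 0 < a) (hm : 0 < m2)
include hL ha hm

/-- ★★★ **`ln 𝒩(Δ_eff(1)) = |n|·ln 𝒩(Δ^{(K)})`** (`𝕜 = ℝ`): the flat fibre model's block-field Gaussian normalisation is `|n|` copies of King's scalar one (PART Ε-p's `log_gaussNorm_effLaplacian` by name).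
[cite: King1986, (2.6) p.652, (3.89) p.668] -/
theorem log_gaussNorm_effLapU_flat :
    Real.log (gaussNorm (effLapU T M a ((L : ℝ) ^ 2) m2 (fun _ => (1 : Matrix n n ℝ)))) = Fintype.card n * Real.log (gaussNorm (effLaplacian L M a ((L : ℝ) ^ 2) m2)) := by
  have hc : (0 : ℝ) ≤ (L : ℝ) ^ 2 := by positivity
  have h1 := flat_mem_unitaryGroup (L := L) (d := d) M (n := n) (𝕜 := ℝ)
  rw [log_gaussNorm_effLapU T M ha hc hm h1, log_gaussNorm_effLaplacian L M ha hc hm]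
  have h := log_re_det_effLapU_flat T M hL ha hm (𝕜 := ℝ) (n := n)
  rw [RCLike.re_to_real] at h
  rw [h, Fintype.card_prod]
  push_cast
  ring

/-- ★★★ **`|ln 𝒩(Δ_eff(U)) − |n|·ln 𝒩(Δ^{(K)})| ≤ ½N·ln(1+a∕m²)`** for every real-orthogonal background `U` — King's `E₀` of the fibre model stays within `½ln(1+a∕m²)` per block dof of `|n|` copies of
the scalar closed form. [cite: King1986, (2.6) p.652, (3.89)–(3.90) pp.668–669, (4.33) p.674] -/
theorem abs_log_gaussNorm_effLapU_sub_flat_le {U : Tor (fine L M) × Fin (d + 1) → Matrix n n ℝ} (hU : ∀ bd, U bd ∈ Matrix.unitaryGroup n ℝ) :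
    |Real.log (gaussNorm (effLapU T M a ((L : ℝ) ^ 2) m2 U)) - Fintype.card n * Real.log (gaussNorm (effLaplacian L M a ((L : ℝ) ^ 2) m2))|
      ≤ (Fintype.card (Tor M × n) : ℝ) / 2 * Real.log (1 + a / m2) := by
  rw [← log_gaussNorm_effLapU_flat T M hL ha hm]
  exact abs_log_gaussNorm_effLapU_sub_le T M ha (by positivity) hm hU (flat_mem_unitaryGroup (L := L) (d := d) M (n := n) (𝕜 := ℝ))

end Gauss

end Summit.QuantumFields.YangMills.BalabanUVNodes.N15KingModelRung.Analytic

end
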